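import Mathlib
import Summits.AnomalousDissipation.AnomalousDissipation.Theses.DyadicWallCascade
import Summits.AnomalousDissipation.AnomalousDissipation.Theorems.DyadicWallCascadeDyadicRealisationFluxSignTools
import Summits.AnomalousDissipation.AnomalousDissipation.Theorems.DyadicWallCascadeDyadicRealisationFluxSignTools2
import Summits.AnomalousDissipation.AnomalousDissipation.Theorems.DyadicWallCascadeDyadicRealisationFluxSignTools3
import Summits.AnomalousDissipation.AnomalousDissipation.Theorems.DyadicWallCascadeDyadicRealisationFluxSignTools4
import HarnessLib

/-!
# The energy flux of a viscous wall profile is negative (stub `stub_fluxSign`, line Sketch)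

Crux `DyadicRealisation` of route `DyadicWallCascade` (`Summits/AnomalousDissipation`).  A bounded
smooth mirror-symmetric force-free steady Navier–Stokes pair `(W, P)` on `ℝ³` whose dyadic
blow-downs converge uniformly on the band `1 ≤ X₂ ≤ 2` to a half-space hierarchy `(V, Q, C, F)`
forces `F < 0` (energy flows in from infinity towards the dissipating wall).

Proof (tools files `…FluxSignTools`, `…Tools2`–`4`): test the localised energy identity of the
rescaled solutions `(2ᵐW(2ᵐ·), 4ᵐP(2ᵐ·))` with `χ_R(Y₀)χ_R(Y₁)θ(Y₂)` (`fluxSign_scale_ineq`):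
the dissipation is non-negative, the Laplacian term is `O(2⁻ᵐ)`, the horizontal transport terms
are `O(R)`, and the two vertical edges of `θ` carry the same flux by the mirror symmetry, whence
`2∫χ_Rχ_Rρ W₂(|W|²/2+P)(2ᵐ·) ≤ 2⁻ᵐA + O(R)`.  Let `m → ∞` (uniform convergence on the band,
`fluxSign_limit_le`), average horizontally using the band periodicity of `(V, Q)`
(`fluxSign_integral_telescope`: the main term is exactly `4R²·J`) and let `R → ∞`: the cell
average `J = ∫κ(Y₀)κ(Y₁)ρ_b(Y₂) V₂(|V|²/2+Q)` of the flux density over the layer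
`1 < Y₂ < 1 + 1/b` is `≤ 0` for every `b ≥ 1`.  By uniform continuity of the flux density near the
plane `Y₂ = 1`, `J ≥ F − F/4` for `b` large (`fluxSign_lower_eval`), so `F ≤ 0`; and `F ≠ 0`.
-/

open MeasureTheory Set Filter Topology Function

set_option linter.dupNamespace false

namespace Summit.AnomalousDissipation.AnomalousDissipation.Theorems

/-- **The energy flux of a viscous wall profile is negative.**  For a bounded smooth
mirror-symmetric force-free steady Navier–Stokes pair `(W, P)` on `ℝ³` (unit viscosity) whose
dyadic blow-downs converge uniformly on the band `1 ≤ X₂ ≤ 2` to a half-space hierarchy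
`(V, Q, C, F)` (bounded, band-periodic, with energy flux `F ≠ 0` through the unit square of
`X₂ = 1`), the flux is negative: `F < 0`.  (Localised energy identity at every dyadic scale,
blow-down limit, horizontal averaging, thin-layer limit; see the module docstring.) [folklore] -/
theorem stub_fluxSign :
    ∀ (W : EuclideanSpace ℝ (Fin 3) → EuclideanSpace ℝ (Fin 3)) (P : EuclideanSpace ℝ (Fin 3) → ℝ)
    (V : EuclideanSpace ℝ (Fin 3) → EuclideanSpace ℝ (Fin 3)) (Q : EuclideanSpace ℝ (Fin 3) → ℝ) (C
    F C' : ℝ), (ContDiffOn ℝ ((⊤ : ℕ∞) : WithTop ℕ∞) V {X : EuclideanSpace ℝ (Fin 3) | 0 < X 2} ∧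
    ContDiffOn ℝ ((⊤ : ℕ∞) : WithTop ℕ∞) Q {X : EuclideanSpace ℝ (Fin 3) | 0 < X 2} ∧ (∀ X :
    EuclideanSpace ℝ (Fin 3), 0 < X 2 → ‖V X‖ ≤ C ∧ |Q X| ≤ C) ∧ (∀ X : EuclideanSpace ℝ (Fin 3), 0
    < X 2 → ∑ i : Fin 3, (fderiv ℝ V X (EuclideanSpace.single i (1 : ℝ))) i = 0) ∧ (∀ X :
    EuclideanSpace ℝ (Fin 3), 0 < X 2 → (fderiv ℝ V X) (V X) + gradient Q X = 0) ∧ (∀ X :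
    EuclideanSpace ℝ (Fin 3), 0 < X 2 → V ((2 : ℝ) • X) = V X ∧ Q ((2 : ℝ) • X) = Q X) ∧ (∀ X :
    EuclideanSpace ℝ (Fin 3), 1 ≤ X 2 → X 2 ≤ 2 → V (X + EuclideanSpace.single 0 (1 : ℝ)) = V X ∧ V
    (X + EuclideanSpace.single 1 (1 : ℝ)) = V X ∧ Q (X + EuclideanSpace.single 0 (1 : ℝ)) = Q X ∧ Q
    (X + EuclideanSpace.single 1 (1 : ℝ)) = Q X) ∧ (∫ q in Set.Icc (0 : ℝ) 1 ×ˢ Set.Icc (0 : ℝ) 1,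
    (V !₂[q.1, q.2, (1 : ℝ)]) 2 = 0) ∧ F ≠ 0 ∧ (∫ q in Set.Icc (0 : ℝ) 1 ×ˢ Set.Icc (0 : ℝ) 1, (V
    !₂[q.1, q.2, (1 : ℝ)]) 2 * (‖V !₂[q.1, q.2, (1 : ℝ)]‖ ^ 2 / 2 + Q !₂[q.1, q.2, (1 : ℝ)]) = F)) ∧
    ContDiff ℝ ((⊤ : ℕ∞) : WithTop ℕ∞) W ∧ ContDiff ℝ ((⊤ : ℕ∞) : WithTop ℕ∞) P ∧ (∀ X :
    EuclideanSpace ℝ (Fin 3), ‖W X‖ ≤ C' ∧ |P X| ≤ C') ∧ (∀ X : EuclideanSpace ℝ (Fin 3), W (X - (2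
    * X 2) • EuclideanSpace.single 2 (1 : ℝ)) = W X - (2 * (W X) 2) • EuclideanSpace.single 2 (1 :
    ℝ) ∧ P (X - (2 * X 2) • EuclideanSpace.single 2 (1 : ℝ)) = P X) ∧ (∀ X : EuclideanSpace ℝ (Fin
    3), ∑ i : Fin 3, (fderiv ℝ W X (EuclideanSpace.single i (1 : ℝ))) i = 0) ∧ (∀ X : EuclideanSpace
    ℝ (Fin 3), (fderiv ℝ W X) (W X) + gradient P X = ∑ i : Fin 3, fderiv ℝ (fun Y => fderiv ℝ W Y
    (EuclideanSpace.single i (1 : ℝ))) X (EuclideanSpace.single i (1 : ℝ))) ∧ (∀ ε : ℝ, 0 < ε → ∃ M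
    : ℕ, ∀ m : ℕ, M ≤ m → ∀ X : EuclideanSpace ℝ (Fin 3), 1 ≤ X 2 → X 2 ≤ 2 → ‖W ((2 : ℝ) ^ m • X) -
    V X‖ ≤ ε ∧ |P ((2 : ℝ) ^ m • X) - Q X| ≤ ε) → F < 0 := by
  intro W P V Q C F C' h
  obtain ⟨⟨hVs, hQs, hbdd, -, -, -, hper, -, hF, hflux⟩, hWs, hPs, hWb, hmir, hWdiv, hNS, hbd⟩ :=
    h
  rcases lt_or_gt_of_ne hF with hlt | hFpos
  · exact hlt
  exfalso
  -- ### the regularised flux density of the limit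
  set π : EuclideanSpace ℝ (Fin 3) → EuclideanSpace ℝ (Fin 3) :=
    fun Y => !₂[Y 0, Y 1, max (Y 2) 2⁻¹] with hπ
  have hπc : Continuous π := by rw [hπ]; fun_prop
  have hπ0 : ∀ Y, (π Y) 0 = Y 0 := fun Y => by simp [hπ]
  have hπ1 : ∀ Y, (π Y) 1 = Y 1 := fun Y => by simp [hπ]
  have hπ2 : ∀ Y, (π Y) 2 = max (Y 2) 2⁻¹ := fun Y => by simp [hπ]
  have hπH : ∀ Y, π Y ∈ {X : EuclideanSpace ℝ (Fin 3) | 0 < X 2} := fun Y => by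
    rw [mem_setOf_eq, hπ2]; exact lt_max_of_lt_right (by norm_num)
  have hπid : ∀ Y : EuclideanSpace ℝ (Fin 3), 2⁻¹ ≤ Y 2 → π Y = Y := fun Y hY => by
    ext i; fin_cases i <;> simp [hπ, max_eq_left hY]
  set Φ : EuclideanSpace ℝ (Fin 3) → ℝ :=
    fun Y => (V (π Y)) 2 * (‖V (π Y)‖ ^ 2 / 2 + Q (π Y)) with hΦ
  have hVπ : Continuous fun Y => V (π Y) := hVs.continuousOn.comp_continuous hπc hπH
  have hQπ : Continuous fun Y => Q (π Y) := hQs.continuousOn.comp_continuous hπc hπH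
  have hΦc : Continuous Φ :=
    ((PiLp.continuous_apply 2 _ 2).comp hVπ).mul (((hVπ.norm.pow 2).div_const 2).add hQπ)
  have hΦeq : ∀ Y : EuclideanSpace ℝ (Fin 3), 2⁻¹ ≤ Y 2 →
      Φ Y = (V Y) 2 * (‖V Y‖ ^ 2 / 2 + Q Y) := fun Y hY => by
    simp only [hΦ]; rw [hπid Y hY]
  have he0 : ∀ Y : EuclideanSpace ℝ (Fin 3),
      (Y + EuclideanSpace.single (0 : Fin 3) (1 : ℝ)) 2 = Y 2 := fun Y => by simp
  have he1 : ∀ Y : EuclideanSpace ℝ (Fin 3),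
      (Y + EuclideanSpace.single (1 : Fin 3) (1 : ℝ)) 2 = Y 2 := fun Y => by simp
  have hΦper : ∀ Y : EuclideanSpace ℝ (Fin 3), 1 ≤ Y 2 → Y 2 ≤ 2 →
      Φ (Y + EuclideanSpace.single 0 (1 : ℝ)) = Φ Y ∧ Φ (Y + EuclideanSpace.single 1 (1 : ℝ)) = Φ Y := by
    intro Y h1 h2
    have hY : 2⁻¹ ≤ Y 2 := by linarith
    obtain ⟨pV0, pV1, pQ0, pQ1⟩ := hper Y h1 h2
    rw [hΦeq Y hY, hΦeq _ (by rw [he0]; exact hY), hΦeq _ (by rw [he1]; exact hY), pV0, pV1, pQ0,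
      pQ1]
    exact ⟨rfl, rfl⟩
  -- ### the thickness of the layer, from uniform continuity of `Φ`
  obtain ⟨δ, hδ, hUC⟩ := fluxSign_unif_cont Φ hΦc (F / 4) (by linarith)
  set b : ℝ := max 1 δ⁻¹ with hb
  have hb1 : 1 ≤ b := le_max_left _ _
  have hb0 : 0 < b := by linarith
  have hbδ : b⁻¹ ≤ δ := inv_le_of_inv_le₀ hδ (le_max_right _ _)
  have hbinv1 : b⁻¹ ≤ 1 := inv_le_one_of_one_le₀ hb1
  -- ### the profiles
  obtain ⟨S1, κ, χ, ρf, θf, ⟨hS1c, hS1cs, hS1nn, -, hS1i⟩, ⟨hκc, hκcs, hκnn, hκ0, hκ2, hκ1⟩, hχ,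
    hρθ⟩ := fluxSign_profiles
  obtain ⟨hρc, hρnn, hρsupp, hρi, hθs, hθcs, hθ01, -, hθd⟩ := hρθ b hb1
  have hρcs : HasCompactSupport (ρf b) :=
    HasCompactSupport.of_support_subset_isCompact (isCompact_Icc (a := (1 : ℝ)) (b := 2))
      fun s hs => ⟨(hρsupp s hs).1.le, by linarith [(hρsupp s hs).2]⟩
  have hρr : ∃ r : ℝ, ∀ t, ρf b t ≠ 0 → |t| ≤ r :=
    ⟨2, fun t ht => abs_le.2 ⟨by linarith [(hρsupp t ht).1], by linarith [(hρsupp t ht).2]⟩⟩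
  have hκr : ∃ r : ℝ, ∀ t, κ t ≠ 0 → |t| ≤ r := by
    refine ⟨2, fun t ht => abs_le.2 ⟨?_, ?_⟩⟩
    · by_contra h'; exact ht (hκ0 t (by linarith))
    · by_contra h'; exact ht (hκ2 t (by linarith))
  have hκint : Integrable κ := hκc.integrable_of_hasCompactSupport hκcs
  have hκi : ∫ t, κ t = 1 := by
    have := fluxSign_cell_average_one κ (fun _ => 1) hκc continuous_const hκ0 hκ2 hκ1
      (fun _ => rfl)
    simpa using this
  have hχi : ∀ R : ℕ, ∫ t, χ R t = 2 * R := fun R => by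
    simp_rw [(hχ R).2.2.2.1]
    rw [fluxSign_integral_sum_translates κ R hκint, hκi, mul_one]
  set Cw : ℝ := C' * (C' ^ 2 / 2 + C') with hCw
  set Kθ : ℝ := ∫ s, θf b s with hKθ
  have hC'0 : 0 ≤ C' := (norm_nonneg _).trans (hWb 0).1
  have hCw0 : 0 ≤ Cw := by rw [hCw]; positivity
  have hKθ0 : 0 ≤ Kθ := integral_nonneg fun s => (hθ01 s).1
  have hWc : Continuous W := hWs.continuous
  have hPc : Continuous P := hPs.continuous
  have huc : ∀ m : ℕ, Continuous fun Y : EuclideanSpace ℝ (Fin 3) =>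
      (W ((2 : ℝ) ^ m • Y)) 2 * (‖W ((2 : ℝ) ^ m • Y)‖ ^ 2 / 2 + P ((2 : ℝ) ^ m • Y)) := by
    intro m
    have hw : Continuous fun Y : EuclideanSpace ℝ (Fin 3) => W ((2 : ℝ) ^ m • Y) :=
      hWc.comp (continuous_const_smul _)
    exact ((PiLp.continuous_apply 2 _ 2).comp hw).mul
      (((hw.norm.pow 2).div_const 2).add (hPc.comp (continuous_const_smul _)))
  -- ### the cell average `J` of the limiting flux density is `≤ 0`
  set J : ℝ := ∫ Y : EuclideanSpace ℝ (Fin 3), κ (Y 0) * κ (Y 1) * (ρf b (Y 2) * Φ Y) with hJ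
  have hJle : ∀ R : ℕ, 2 * ((2 * (R : ℝ)) ^ 2 * J) ≤ 4 * Cw * ((2 * R) * Kθ) := by
    intro R
    obtain ⟨hχs, hχcs, hχ01, hχsum, hχd⟩ := hχ R
    have hχr := fluxSign_exists_abs_le_of_hasCompactSupport hχcs
    obtain ⟨A, hA⟩ := fluxSign_scale_ineq W P C' S1 (χ R) (ρf b) (θf b) R hWs hPs hWdiv hNS hWb
      hmir hS1c hS1cs hS1nn hS1i hχs hχcs hχ01 hχd hρc hρcs hθs hθcs hθ01 hθd
    -- the blow-down limit
    have hg : Integrable (fun Y : EuclideanSpace ℝ (Fin 3) => χ R (Y 0) * χ R (Y 1) * ρf b (Y 2)) := by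
      simpa using fluxSign_integrable_prod3 (χ R) (χ R) (ρf b) (fun _ => (1 : ℝ))
        hχs.continuous hχs.continuous hρc continuous_const hχr hχr hρr
    have hgu : ∀ m : ℕ, Integrable (fun Y : EuclideanSpace ℝ (Fin 3) =>
        χ R (Y 0) * χ R (Y 1) * ρf b (Y 2) *
          ((W ((2 : ℝ) ^ m • Y)) 2 * (‖W ((2 : ℝ) ^ m • Y)‖ ^ 2 / 2 + P ((2 : ℝ) ^ m • Y)))) :=
      fun m => fluxSign_integrable_prod3 (χ R) (χ R) (ρf b) _ hχs.continuous hχs.continuous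
        hρc (huc m) hχr hχr hρr
    have hgΦ : Integrable (fun Y : EuclideanSpace ℝ (Fin 3) =>
        χ R (Y 0) * χ R (Y 1) * ρf b (Y 2) * Φ Y) :=
      fluxSign_integrable_prod3 (χ R) (χ R) (ρf b) Φ hχs.continuous hχs.continuous hρc hΦc
        hχr hχr hρr
    have hconv : ∀ ε : ℝ, 0 < ε → ∃ M : ℕ, ∀ m : ℕ, M ≤ m → ∀ Y : EuclideanSpace ℝ (Fin 3),
        χ R (Y 0) * χ R (Y 1) * ρf b (Y 2) ≠ 0 →
          |(W ((2 : ℝ) ^ m • Y)) 2 * (‖W ((2 : ℝ) ^ m • Y)‖ ^ 2 / 2 + P ((2 : ℝ) ^ m • Y)) - Φ Y|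
            ≤ ε := by
      intro ε hε
      set L : ℝ := C' ^ 2 / 2 + |C'| + |C| * ((|C'| + |C|) / 2 + 1) with hL
      have hL0 : 0 ≤ L := by rw [hL]; positivity
      obtain ⟨M, hM⟩ := hbd (ε / (2 * L + 2)) (by positivity)
      refine ⟨M, fun m hm Y hY => ?_⟩
      have hρ0 : ρf b (Y 2) ≠ 0 := fun h0 => hY (by rw [h0, mul_zero])
      have h1 : 1 ≤ Y 2 := (hρsupp _ hρ0).1.le
      have h2 : Y 2 ≤ 2 := by linarith [(hρsupp _ hρ0).2]
      obtain ⟨hWV, hPQ⟩ := hM m hm Y h1 h2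
      rw [hΦeq Y (by linarith)]
      have hV := hbdd Y (by linarith)
      have key := fluxSign_density_lipschitz (W ((2 : ℝ) ^ m • Y)) (V Y) (P ((2 : ℝ) ^ m • Y))
        (Q Y) C C' (hWb _).1 (hWb _).2 hV.1
      refine key.trans ?_
      rw [← hL]
      calc L * (‖W ((2 : ℝ) ^ m • Y) - V Y‖ + |P ((2 : ℝ) ^ m • Y) - Q Y|)
          ≤ L * (ε / (2 * L + 2) + ε / (2 * L + 2)) := by gcongr
        _ ≤ ε := by
            rw [← two_mul, ← mul_assoc, mul_div_assoc', div_le_iff₀ (by positivity)]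
            nlinarith
    have hineq : ∀ m : ℕ, 2 * ∫ Y : EuclideanSpace ℝ (Fin 3), χ R (Y 0) * χ R (Y 1) * ρf b (Y 2) *
        ((W ((2 : ℝ) ^ m • Y)) 2 * (‖W ((2 : ℝ) ^ m • Y)‖ ^ 2 / 2 + P ((2 : ℝ) ^ m • Y))) ≤
        ((2 : ℝ) ^ m)⁻¹ * A + 4 * (C' * (C' ^ 2 / 2 + C')) * ((∫ t, χ R t) * ∫ s, θf b s) :=
      fun m => hA ((2 : ℝ) ^ m) (by positivity)
    have hlim := fluxSign_limit_le (fun Y => χ R (Y 0) * χ R (Y 1) * ρf b (Y 2)) Φ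
      (fun m Y => (W ((2 : ℝ) ^ m • Y)) 2 * (‖W ((2 : ℝ) ^ m • Y)‖ ^ 2 / 2 + P ((2 : ℝ) ^ m • Y)))
      A (4 * (C' * (C' ^ 2 / 2 + C')) * ((∫ t, χ R t) * ∫ s, θf b s)) hg hgu hgΦ hconv hineq
    -- horizontal averaging
    have htel := fluxSign_integral_telescope κ (fun Y => ρf b (Y 2) * Φ Y) R hκc hκcs
      ((hρc.comp (PiLp.continuous_apply 2 _ 2)).mul hΦc)
      ⟨2, fun Y hY => by
        have hρ0 : ρf b (Y 2) ≠ 0 := fun h0 => hY (by rw [h0, zero_mul])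
        exact abs_le.2 ⟨by linarith [(hρsupp _ hρ0).1], by linarith [(hρsupp _ hρ0).2]⟩⟩
      (fun Y => by
        simp only [he0]
        by_cases h0 : ρf b (Y 2) = 0
        · rw [h0, zero_mul, zero_mul]
        · rw [(hΦper Y (hρsupp _ h0).1.le (by linarith [(hρsupp _ h0).2])).1])
      (fun Y => by
        simp only [he1]
        by_cases h0 : ρf b (Y 2) = 0
        · rw [h0, zero_mul, zero_mul]
        · rw [(hΦper Y (hρsupp _ h0).1.le (by linarith [(hρsupp _ h0).2])).2])
    have hmain : ∫ Y : EuclideanSpace ℝ (Fin 3), χ R (Y 0) * χ R (Y 1) * ρf b (Y 2) * Φ Y =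
        (2 * (R : ℝ)) ^ 2 * J := by
      rw [hJ, ← htel]
      refine integral_congr_ae (Eventually.of_forall fun Y => ?_)
      simp only
      rw [hχsum, hχsum]
      ring
    rw [hmain, hχi R, ← hCw, ← hKθ] at hlim
    linarith
  have hJ0 : J ≤ 0 := by
    by_contra hJpos
    push Not at hJpos
    obtain ⟨R, hR⟩ := exists_nat_gt (Cw * Kθ / J)
    have h1 := hJle (R + 1)
    push_cast at h1
    have hR1 : Cw * Kθ / J < (R : ℝ) + 1 := hR.trans (by linarith)
    rw [div_lt_iff₀ hJpos] at hR1
    nlinarith [mul_nonneg hCw0 hKθ0]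
  -- ### the lower bound `J ≥ F - F/4` from the flux clause and uniform continuity near `X₂ = 1`
  set h2 : ℝ × ℝ → ℝ := fun q => Φ !₂[q.1, q.2, (1 : ℝ)] with hh2
  have hpt : Continuous fun q : ℝ × ℝ => (!₂[q.1, q.2, (1 : ℝ)] : EuclideanSpace ℝ (Fin 3)) := by
    fun_prop
  have hh2c : Continuous h2 := hΦc.comp hpt
  have hpt2 : ∀ a c : ℝ, (!₂[a, c, (1 : ℝ)] : EuclideanSpace ℝ (Fin 3)) 2 = 1 := by
    intro a c; simp
  have hh2F : ∫ q in Set.Icc (0 : ℝ) 1 ×ˢ Set.Icc (0 : ℝ) 1, h2 q = F := by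
    rw [← hflux]
    refine setIntegral_congr_fun (measurableSet_Icc.prod measurableSet_Icc) fun q _ => ?_
    simp only [hh2]
    rw [hΦeq _ (by rw [hpt2]; norm_num)]
  have hline0 : ∀ a c : ℝ, (!₂[a + 1, c, (1 : ℝ)] : EuclideanSpace ℝ (Fin 3)) =
      !₂[a, c, (1 : ℝ)] + EuclideanSpace.single 0 (1 : ℝ) := by
    intro a c; ext i; fin_cases i <;> simp
  have hline1 : ∀ a c : ℝ, (!₂[a, c + 1, (1 : ℝ)] : EuclideanSpace ℝ (Fin 3)) =
      !₂[a, c, (1 : ℝ)] + EuclideanSpace.single 1 (1 : ℝ) := by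
    intro a c; ext i; fin_cases i <;> simp
  have hh2per1 : ∀ q : ℝ × ℝ, h2 (q.1 + 1, q.2) = h2 q := fun q => by
    simp only [hh2]
    rw [hline0, (hΦper _ (by rw [hpt2]) (by rw [hpt2]; norm_num)).1]
  have hh2per2 : ∀ q : ℝ × ℝ, h2 (q.1, q.2 + 1) = h2 q := fun q => by
    simp only [hh2]
    rw [hline1, (hΦper _ (by rw [hpt2]) (by rw [hpt2]; norm_num)).2]
  have hlow := fluxSign_lower_eval κ (ρf b) h2 (F / 4) hκc hκ0 hκ2 hκ1 hh2c hh2per1 hh2per2 hρi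
  rw [hh2F] at hlow
  -- pointwise comparison
  have hJint : Integrable fun Y : EuclideanSpace ℝ (Fin 3) => κ (Y 0) * κ (Y 1) * (ρf b (Y 2) * Φ Y) :=
    (fluxSign_integrable_prod3 κ κ (ρf b) Φ hκc hκc hρc hΦc hκr hκr hρr).congr
      (Eventually.of_forall fun Y => by simp only; ring)
  have hRint : Integrable fun Y : EuclideanSpace ℝ (Fin 3) =>
      κ (Y 0) * κ (Y 1) * ρf b (Y 2) * (h2 (Y 0, Y 1) - F / 4) :=
    fluxSign_integrable_prod3 κ κ (ρf b) (fun Y => h2 (Y 0, Y 1) - F / 4) hκc hκc hρc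
      ((hh2c.comp ((PiLp.continuous_apply 2 _ 0).prodMk (PiLp.continuous_apply 2 _ 1))).sub
        continuous_const) hκr hκr hρr
  have hptw : ∀ Y : EuclideanSpace ℝ (Fin 3),
      κ (Y 0) * κ (Y 1) * ρf b (Y 2) * (h2 (Y 0, Y 1) - F / 4) ≤
        κ (Y 0) * κ (Y 1) * (ρf b (Y 2) * Φ Y) := by
    intro Y
    rw [show κ (Y 0) * κ (Y 1) * (ρf b (Y 2) * Φ Y) = κ (Y 0) * κ (Y 1) * ρf b (Y 2) * Φ Y by ring]
    have hw : 0 ≤ κ (Y 0) * κ (Y 1) * ρf b (Y 2) :=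
      mul_nonneg (mul_nonneg (hκnn _) (hκnn _)) (hρnn _)
    by_cases hz : κ (Y 0) * κ (Y 1) * ρf b (Y 2) = 0
    · rw [hz, zero_mul, zero_mul]
    · refine mul_le_mul_of_nonneg_left ?_ hw
      have hk0 : κ (Y 0) ≠ 0 := fun h0 => hz (by rw [h0]; ring)
      have hk1 : κ (Y 1) ≠ 0 := fun h0 => hz (by rw [h0]; ring)
      have hr2 : ρf b (Y 2) ≠ 0 := fun h0 => hz (by rw [h0]; ring)
      have hY0 : 0 ≤ Y 0 ∧ Y 0 ≤ 2 :=
        ⟨by by_contra h'; exact hk0 (hκ0 _ (by linarith)), by by_contra h'; exact hk0 (hκ2 _ (by linarith))⟩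
      have hY1 : 0 ≤ Y 1 ∧ Y 1 ≤ 2 :=
        ⟨by by_contra h'; exact hk1 (hκ0 _ (by linarith)), by by_contra h'; exact hk1 (hκ2 _ (by linarith))⟩
      have hY2 : 1 < Y 2 ∧ Y 2 < 1 + b⁻¹ := hρsupp _ hr2
      set Y' : EuclideanSpace ℝ (Fin 3) := !₂[Y 0, Y 1, (1 : ℝ)] with hY'
      have hd : Y - Y' = (Y 2 - 1) • EuclideanSpace.single 2 (1 : ℝ) := by
        ext i; fin_cases i <;> simp [hY']
      have hnY : ‖Y‖ ≤ 10 := (fluxSign_norm_le_coord Y).trans (by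
        rw [abs_of_nonneg hY0.1, abs_of_nonneg hY1.1, abs_of_pos (by linarith)]; linarith)
      have hnY' : ‖Y'‖ ≤ 10 := (fluxSign_norm_le_coord Y').trans (by
        simp only [hY']
        simp only [Matrix.cons_val_zero, Matrix.cons_val_one, Matrix.cons_val, abs_one]
        rw [abs_of_nonneg hY0.1, abs_of_nonneg hY1.1]; linarith)
      have hdist : ‖Y - Y'‖ ≤ δ := by
        have hn1 : ‖(EuclideanSpace.single (2 : Fin 3) (1 : ℝ) : EuclideanSpace ℝ (Fin 3))‖ = 1 := by
          simp
        rw [hd, norm_smul, hn1, mul_one, Real.norm_eq_abs, abs_of_pos (by linarith)]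
        linarith
      have := abs_le.1 (hUC Y Y' hnY hnY' hdist)
      show h2 (Y 0, Y 1) - F / 4 ≤ Φ Y
      simp only [hh2]
      linarith
  have hJge : F - F / 4 ≤ J := by
    rw [← hlow, hJ]
    exact integral_mono hRint hJint hptw
  linarith

end Summit.AnomalousDissipation.AnomalousDissipation.Theorems
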